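import Summits.BirchSwinnertonDyer.Rank1Residual.Additive.LevelToLayerZero
import HarnessLib

/-!
# Selmer structures on `E[p^m]` versus subgroups of `H¹(K_0, E[p^∞])` cut out by level-`∞`
# conditions: `H¹_𝓖(K, E[p^m]) = Ψ_m⁻¹(A)`, `Ψ_m(H¹_𝓖) = A` once `p^m A = 0`, and
# **`[H¹_𝓖 : H¹_𝓕] = [A : S]`** — the vocabulary BRIDGE, part 2 (cell `b2b-bsdres`, CLASS-CLOSURE
# lane, class O10 — x1b GEN 38, class lead; file 72 of the series)

HONEST FRAMING (cell `b2b-bsdres`, run/shared/lean/b2b/bsd-rank1-residual/, verbatim in every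
file): the goal of the cell is to DELETE the COMBINATION-SHAPED residual classes of the
Birch–Swinnerton-Dyer formula for ALL analytic-rank `≤ 1` elliptic curves over `ℚ` — "full BSD
formula for every rank `≤ 1` curve in class `C`" assembled STRICTLY from published theorems — so
that the rank-`≤ 1` remainder becomes exactly the CONSTRUCTION-SHAPED classes, which are TYPED
(missing-input `Prop`s), NOT attempted. This is not "finishing BSD". CLASS-CLOSURE lane: prove
what is provable now; shrink each hard class to its core with data; no claim beyond stated classes;
research routes on CONSTRUCTION-SHAPED X12 / O10; census / instrument output = EVIDENCE / conjecture
items, NEVER a Literature fact; `RESIDUAL-MAP.md` marks change only by signed lines. THIS FILE: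
TOOL THEOREMS ONLY — no definition, no named Literature fact, no Summits-side fact `def … : Prop`,
no `sorry`, axioms standard; pure Galois-cohomology bookkeeping over ANY number field `K`, any
prime `p`, any `ℤ_p`-extension `κ`, any level `p^m`; nothing is booked; no label / mark / count /
sub-cell moves; (C1_η), (C2_η-GZ), (C3_η) stay typed as filed (cc-typer-6's pen); O10 stays OPEN /
CONSTRUCTION-SHAPED; nothing about `BSD(W, p)` of any pair is claimed.

## What (all kernel theorems; `Ψ_m`, `θ_v` as in file 71, written out)

* §1 ABSTRACT TRANSFER along `Ψ_m : H¹(K, E[p^m]) → H¹(K_0, E[p^∞])` (bundled as an `AddMonoidHom`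
  composite): if a Selmer structure `𝓖` on `E[p^m]` and a subgroup `A ≤ H¹(K_0, E[p^∞])` satisfy
  `c ∈ H¹_𝓖 ↔ Ψ_m c ∈ A` for all `c`, then `H¹_𝓖 = Ψ_m⁻¹(A)`; if `p^m A = 0` (and `W` is elliptic,
  `E(K̄)` divisible) then `A ⊆ range Ψ_m`, **`Ψ_m(H¹_𝓖) = A`**, and for two such pairs
  `(𝓕, S)`, `(𝓖, A)`: **`[H¹_𝓖 : H¹_𝓕 ∩ H¹_𝓖] = [A : S ∩ A]`** (`relIndex`, Mathlib
  `AddSubgroup.relIndex_comap`; NO injectivity needed); with `E[p^∞]^{Γ_K} = 0` also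
  `#H¹_𝓖 = #A`.
* §2 THE TOWER STRUCTURE AT LEVEL `m`: a Selmer structure `𝓣` with
  `𝓣_v = θ_v⁻¹(𝒦_{v,0})` at the finite places and `𝓣_w = 𝓚_w` (Kummer) at the infinite places has
  **`c ∈ H¹_𝓣 ↔ Ψ_m c ∈ A_0 = h_0⁻¹(Sel_{p^∞}(E/K_∞))`** (file 71 §4); refining `𝓣` at one place
  `v₀` by a local condition `L` that detects an extra condition `Σ` on `A_0`
  (`Ψ_m c ∈ A_0 → (loc_{v₀} c ∈ L ↔ Ψ_m c ∈ Σ)`) gives `c ∈ H¹_{𝓣[v₀ ↦ 𝓣_{v₀} ⊓ L]} ↔ Ψ_m c ∈ A_0 ⊓ Σ`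
  — the shape of `A₀ = Sel^{loc,∞}` (`= A_0 ⊓` the signed condition at `p`) of files 42–59.
* §3 WHERE `𝒦_{v,0}[p^∞] = 0` THE TOWER CONDITION IS KUMMER: `θ_v⁻¹(𝒦_{v,0}) = 𝓚_v` as subgroups
  (file 71 §3); so `𝓣` agrees with the Kummer structure off the finite set of places where
  `p ∣ #𝒦_{v,0}[p^∞]` (`= p^{ord_p c_v}` at `v ∤ p`, B4) — the hypothesis `h𝓖off` of the count (C)
  at finite level (files 63, 68–70).

References: [GreenbergLNM1716] §3 pp. 85–90 (the maps `h_n`, `g_n`, `r_v`), §5 p. 114;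
Mazur–Rubin, *Kolyvagin systems* (2004) Def. 2.1.1; [SerreGaloisCohomology1997] I.§2.4.
-/

noncomputable section

open scoped Classical

open WeierstrassCurve Literature.NumberTheory.EllipticCurves Literature.NumberTheory.GaloisRepresentations
  NumberField IsDedekindDomain Field
open Literature.NumberTheory.GaloisRepresentations.DiscreteGaloisModule (SelmerStructure)
open Summit.BirchSwinnertonDyer.Rank1Residual.X11b.Levels
open scoped ContRepresentation

namespace Summit.BirchSwinnertonDyer.Rank1Residual.Additive.LevelBridge

universe u

/-! ### §1 Abstract transfer along `Ψ_m` -/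

section Transfer

variable {K : Type u} [Field K] [NumberField K] (W : WeierstrassCurve K) (p : ℕ) [hp : Fact p.Prime]
  (κ : ZpExtension K p) (m : ℕ)

omit [NumberField K] in
/-- Unfolding the bundled `Ψ_m = res_{K_0} ∘ (E[p^m] ↪ E[p^∞])_*` (an `AddMonoidHom` composite) on a
class. [folklore] -/
theorem levelToLayerZero_comp_apply (c : galoisCohomology (W.torsionGaloisModule ((p ^ m : ℕ) : ℤ)) 1) :
    ((resH1Hom (subgroupIncl (κ.layerSubgroup 0)) (AddMonoidHom.id (geomPrimaryTorsion W p))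
        (fun _ _ ↦ rfl)).comp (galoisCohomology.map (primaryInclusion W p m) 1)) c =
      resH1Hom (subgroupIncl (κ.layerSubgroup 0)) (AddMonoidHom.id (geomPrimaryTorsion W p))
        (fun _ _ ↦ rfl) (galoisCohomology.map (primaryInclusion W p m) 1 c) :=
  rfl

/-- **`H¹_𝓖 = Ψ_m⁻¹(A)`** when membership corresponds: `c ∈ H¹_𝓖 ↔ Ψ_m c ∈ A`. [folklore] -/
theorem selmerGroup_eq_comap_of_iff (𝓖 : SelmerStructure (W.torsionGaloisModule ((p ^ m : ℕ) : ℤ)))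
    (A : AddSubgroup (W.subgroupH1 p (κ.layerSubgroup 0)))
    (hmem : ∀ c, c ∈ 𝓖.selmerGroup ↔
      resH1Hom (subgroupIncl (κ.layerSubgroup 0)) (AddMonoidHom.id (geomPrimaryTorsion W p))
        (fun _ _ ↦ rfl) (galoisCohomology.map (primaryInclusion W p m) 1 c) ∈ A) :
    𝓖.selmerGroup = A.comap ((resH1Hom (subgroupIncl (κ.layerSubgroup 0))
      (AddMonoidHom.id (geomPrimaryTorsion W p)) (fun _ _ ↦ rfl)).comp
        (galoisCohomology.map (primaryInclusion W p m) 1)) := by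
  ext c
  rw [hmem, AddSubgroup.mem_comap, levelToLayerZero_comp_apply]

omit [NumberField K] in
/-- **`A ⊆ range Ψ_m` when `p^m A = 0`** (`W` elliptic, `E(K̄)` divisible): file 71
`exists_levelToLayerZero_eq_of_nsmul_eq_zero`. [cite: GreenbergLNM1716, §5 proof of Prop. 5.8] -/
theorem le_range_levelToLayerZero [W.IsElliptic] (hdiv : W.zsmul_geomPoints_surjective)
    (A : AddSubgroup (W.subgroupH1 p (κ.layerSubgroup 0))) (hA : ∀ z ∈ A, p ^ m • z = 0) :
    A ≤ ((resH1Hom (subgroupIncl (κ.layerSubgroup 0)) (AddMonoidHom.id (geomPrimaryTorsion W p))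
      (fun _ _ ↦ rfl)).comp (galoisCohomology.map (primaryInclusion W p m) 1)).range := by
  intro z hz
  obtain ⟨c, hc⟩ := exists_levelToLayerZero_eq_of_nsmul_eq_zero W p κ m hdiv z (hA z hz)
  exact ⟨c, hc⟩

/-- **`Ψ_m(H¹_𝓖) = A`** when membership corresponds and `p^m A = 0`. [cite: GreenbergLNM1716, §3 p. 85 and §5 p. 114] -/
theorem map_selmerGroup_eq_of_iff [W.IsElliptic] (hdiv : W.zsmul_geomPoints_surjective)
    (𝓖 : SelmerStructure (W.torsionGaloisModule ((p ^ m : ℕ) : ℤ)))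
    (A : AddSubgroup (W.subgroupH1 p (κ.layerSubgroup 0))) (hA : ∀ z ∈ A, p ^ m • z = 0)
    (hmem : ∀ c, c ∈ 𝓖.selmerGroup ↔
      resH1Hom (subgroupIncl (κ.layerSubgroup 0)) (AddMonoidHom.id (geomPrimaryTorsion W p))
        (fun _ _ ↦ rfl) (galoisCohomology.map (primaryInclusion W p m) 1 c) ∈ A) :
    𝓖.selmerGroup.map ((resH1Hom (subgroupIncl (κ.layerSubgroup 0))
      (AddMonoidHom.id (geomPrimaryTorsion W p)) (fun _ _ ↦ rfl)).comp
        (galoisCohomology.map (primaryInclusion W p m) 1)) = A := by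
  rw [selmerGroup_eq_comap_of_iff W p κ m 𝓖 A hmem]
  exact AddSubgroup.map_comap_eq_self (le_range_levelToLayerZero W p κ m hdiv A hA)

/-- **THE INDEX TRANSFER `[H¹_𝓖 : H¹_𝓕 ∩ H¹_𝓖] = [A : S ∩ A]`.** For Selmer structures `𝓕`, `𝓖` on
`E[p^m]` and subgroups `S`, `A ≤ H¹(K_0, E[p^∞])` with `c ∈ H¹_𝓕 ↔ Ψ_m c ∈ S`, `c ∈ H¹_𝓖 ↔ Ψ_m c ∈ A`
and `p^m A = 0`: `H¹_𝓕.relIndex H¹_𝓖 = S.relIndex A` (relative indices of preimages,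
`AddSubgroup.relIndex_comap`, and `Ψ_m(Ψ_m⁻¹ A) = A`). For `S ≤ A` these are `[H¹_𝓖 : H¹_𝓕]` and
`[A : S] = #(A ⧸ S)` — the count (C) for `(𝓕, 𝓖)` IS the count for `(S, A)`. NO injectivity of `Ψ_m`
is needed. [cite: GreenbergLNM1716, §3 pp. 85–90] -/
theorem relIndex_selmerGroup_eq_of_iff [W.IsElliptic] (hdiv : W.zsmul_geomPoints_surjective)
    (𝓕 𝓖 : SelmerStructure (W.torsionGaloisModule ((p ^ m : ℕ) : ℤ)))
    (S A : AddSubgroup (W.subgroupH1 p (κ.layerSubgroup 0))) (hA : ∀ z ∈ A, p ^ m • z = 0)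
    (hS : ∀ c, c ∈ 𝓕.selmerGroup ↔
      resH1Hom (subgroupIncl (κ.layerSubgroup 0)) (AddMonoidHom.id (geomPrimaryTorsion W p))
        (fun _ _ ↦ rfl) (galoisCohomology.map (primaryInclusion W p m) 1 c) ∈ S)
    (hAmem : ∀ c, c ∈ 𝓖.selmerGroup ↔
      resH1Hom (subgroupIncl (κ.layerSubgroup 0)) (AddMonoidHom.id (geomPrimaryTorsion W p))
        (fun _ _ ↦ rfl) (galoisCohomology.map (primaryInclusion W p m) 1 c) ∈ A) :
    𝓕.selmerGroup.relIndex 𝓖.selmerGroup = S.relIndex A := by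
  rw [selmerGroup_eq_comap_of_iff W p κ m 𝓕 S hS, selmerGroup_eq_comap_of_iff W p κ m 𝓖 A hAmem,
    AddSubgroup.relIndex_comap,
    AddSubgroup.map_comap_eq_self (le_range_levelToLayerZero W p κ m hdiv A hA)]

/-- **`#H¹_𝓖 = #A`** when membership corresponds, `p^m A = 0` and `E[p^∞]^{Γ_K} = 0` (`Ψ_m` is then
injective, file 71). [cite: GreenbergLNM1716, §3 p. 85 and §5 p. 114] -/
theorem natCard_selmerGroup_eq_of_iff [W.IsElliptic] (hdiv : W.zsmul_geomPoints_surjective)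
    (hΓ : ∀ Q : W.geomPrimaryTorsion p,
      (∀ σ : absoluteGaloisGroup K, X11b.LocBridge.primaryGaloisModule W p σ Q = Q) → Q = 0)
    (𝓖 : SelmerStructure (W.torsionGaloisModule ((p ^ m : ℕ) : ℤ)))
    (A : AddSubgroup (W.subgroupH1 p (κ.layerSubgroup 0))) (hA : ∀ z ∈ A, p ^ m • z = 0)
    (hmem : ∀ c, c ∈ 𝓖.selmerGroup ↔
      resH1Hom (subgroupIncl (κ.layerSubgroup 0)) (AddMonoidHom.id (geomPrimaryTorsion W p))
        (fun _ _ ↦ rfl) (galoisCohomology.map (primaryInclusion W p m) 1 c) ∈ A) :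
    Nat.card 𝓖.selmerGroup = Nat.card A := by
  rw [← map_selmerGroup_eq_of_iff W p κ m hdiv 𝓖 A hA hmem]
  exact (AddSubgroup.card_map_of_injective (levelToLayerZero_injective W p κ m hΓ)).symm

end Transfer

/-! ### §2 The tower Selmer structure at level `m` and its refinement at one place -/

section TowerStructure

variable {K : Type u} [Field K] [NumberField K] (W : WeierstrassCurve K) (p : ℕ) [hp : Fact p.Prime]
  (κ : ZpExtension K p) (m : ℕ)

/-- **`c ∈ H¹_𝓣 ↔ Ψ_m c ∈ A_0 = h_0⁻¹(Sel_{p^∞}(E/K_∞))`** for a Selmer structure `𝓣` on `E[p^m]` with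
`𝓣_v = θ_v⁻¹(𝒦_{v,0})` (the level-`∞` condition read at level `m`) at every finite place and
`𝓣_w = 𝓚_w` (Kummer) at every infinite place (file 71
`levelToLayerZero_mem_selmerInftyPreimage_iff'`). [cite: GreenbergLNM1716, §3 pp. 85–86] -/
theorem mem_selmerGroup_iff_levelToLayerZero_mem_selmerInftyPreimage
    (𝓣 : SelmerStructure (W.torsionGaloisModule ((p ^ m : ℕ) : ℤ)))
    (h𝓣fin : ∀ v : HeightOneSpectrum (𝓞 K), 𝓣 (Sum.inr v) =
      (W.localTowerKer κ (v.adicCompletion K) 0).comap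
        ((resH1Hom (subgroupIncl (localSubgroup (κ.layerSubgroup 0) (v.adicCompletion K)))
          (AddMonoidHom.id (localPoints W (v.adicCompletion K))) (fun _ _ ↦ rfl)).comp
          (galoisCohomology.map
            (W.torsionPointsMapIntertwining ((p ^ m : ℕ) : ℤ) (v.adicCompletion K)) 1)))
    (h𝓣inf : ∀ w : InfinitePlace K, 𝓣 (Sum.inl w) = W.kummerSelmerStructure ((p ^ m : ℕ) : ℤ) (Sum.inl w))
    (c : galoisCohomology (W.torsionGaloisModule ((p ^ m : ℕ) : ℤ)) 1) :
    c ∈ 𝓣.selmerGroup ↔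
      resH1Hom (subgroupIncl (κ.layerSubgroup 0)) (AddMonoidHom.id (geomPrimaryTorsion W p))
        (fun _ _ ↦ rfl) (galoisCohomology.map (primaryInclusion W p m) 1 c) ∈
        W.selmerInftyPreimage κ 0 := by
  rw [levelToLayerZero_mem_selmerInftyPreimage_iff', SelmerStructure.mem_selmerGroup_iff]
  -- (`Place.Completion (Sum.inr v)` is `v.adicCompletion K` by `rfl`, not syntactically: cross by
  -- `exact`, not `rw`)
  constructor
  · intro h
    refine ⟨fun v ↦ ?_, fun w ↦ ?_⟩
    · have hv := h (Sum.inr v)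
      rw [h𝓣fin v] at hv
      exact AddSubgroup.mem_comap.mp hv
    · have hw := h (Sum.inl w)
      rw [h𝓣inf w] at hw
      exact hw
  · rintro ⟨hfin, hinf⟩ v
    rcases v with w | v
    · rw [h𝓣inf w]
      exact hinf w
    · rw [h𝓣fin v]
      exact AddSubgroup.mem_comap.mpr (hfin v)

omit hp in
/-- Selmer groups of a one-place refinement: `c ∈ H¹_{𝓛[v₀ ↦ 𝓛_{v₀} ⊓ L]} ↔ c ∈ H¹_𝓛 ∧ loc_{v₀} c ∈ L`.
[folklore] -/
theorem mem_selmerGroup_update_inf_iff {n : ℤ} (𝓛 : SelmerStructure (W.torsionGaloisModule n))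
    (v₀ : Place K) (L : AddSubgroup (galoisCohomology ((W.torsionGaloisModule n).toLocal v₀) 1))
    (c : galoisCohomology (W.torsionGaloisModule n) 1) :
    c ∈ SelmerStructure.selmerGroup (Function.update 𝓛 v₀ (𝓛 v₀ ⊓ L)) ↔
      c ∈ 𝓛.selmerGroup ∧ galoisCohomology.localization (W.torsionGaloisModule n) v₀ 1 c ∈ L := by
  simp only [SelmerStructure.mem_selmerGroup_iff]
  constructor
  · intro h
    have h₀ := h v₀
    rw [Function.update_self, AddSubgroup.mem_inf] at h₀
    refine ⟨fun v ↦ ?_, h₀.2⟩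
    by_cases hv : v = v₀
    · subst hv; exact h₀.1
    · have := h v
      rwa [Function.update_of_ne hv] at this
  · rintro ⟨h, hL⟩ v
    by_cases hv : v = v₀
    · subst hv
      rw [Function.update_self, AddSubgroup.mem_inf]
      exact ⟨h v, hL⟩
    · rw [Function.update_of_ne hv]
      exact h v

/-- **Refining the tower structure at one place by a condition that detects `Σ` on `A_0`.** Let `𝓣`
satisfy `c ∈ H¹_𝓣 ↔ Ψ_m c ∈ A_0` and let `L ≤ H¹(K_{v₀}, E[p^m])`, `Σ ≤ H¹(K_0, E[p^∞])` be such that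
for classes with `Ψ_m c ∈ A_0`: `loc_{v₀} c ∈ L ↔ Ψ_m c ∈ Σ` (the extra condition is LOCAL at `v₀`).
Then `c ∈ H¹_{𝓣[v₀ ↦ 𝓣_{v₀} ⊓ L]} ↔ Ψ_m c ∈ A_0 ⊓ Σ` — with `Σ` the level-`∞` signed condition at
`p` this is `A₀ = Sel^{loc,∞}` of the (C3_η) derivation (files 42–59).
[cite: GreenbergLNM1716, §3 pp. 85–86] [cite: Kobayashi2003, §9 (Sel^± over the tower)] -/
theorem mem_selmerGroup_update_inf_iff_levelToLayerZero_mem_inf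
    (𝓣 : SelmerStructure (W.torsionGaloisModule ((p ^ m : ℕ) : ℤ)))
    (A0 : AddSubgroup (W.subgroupH1 p (κ.layerSubgroup 0)))
    (h𝓣 : ∀ c, c ∈ 𝓣.selmerGroup ↔
      resH1Hom (subgroupIncl (κ.layerSubgroup 0)) (AddMonoidHom.id (geomPrimaryTorsion W p))
        (fun _ _ ↦ rfl) (galoisCohomology.map (primaryInclusion W p m) 1 c) ∈ A0)
    (v₀ : Place K)
    (L : AddSubgroup (galoisCohomology ((W.torsionGaloisModule ((p ^ m : ℕ) : ℤ)).toLocal v₀) 1))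
    (Sig : AddSubgroup (W.subgroupH1 p (κ.layerSubgroup 0)))
    (hLSig : ∀ c, resH1Hom (subgroupIncl (κ.layerSubgroup 0)) (AddMonoidHom.id (geomPrimaryTorsion W p))
        (fun _ _ ↦ rfl) (galoisCohomology.map (primaryInclusion W p m) 1 c) ∈ A0 →
      (galoisCohomology.localization (W.torsionGaloisModule ((p ^ m : ℕ) : ℤ)) v₀ 1 c ∈ L ↔
        resH1Hom (subgroupIncl (κ.layerSubgroup 0)) (AddMonoidHom.id (geomPrimaryTorsion W p))
          (fun _ _ ↦ rfl) (galoisCohomology.map (primaryInclusion W p m) 1 c) ∈ Sig))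
    (c : galoisCohomology (W.torsionGaloisModule ((p ^ m : ℕ) : ℤ)) 1) :
    c ∈ SelmerStructure.selmerGroup (Function.update 𝓣 v₀ (𝓣 v₀ ⊓ L)) ↔
      resH1Hom (subgroupIncl (κ.layerSubgroup 0)) (AddMonoidHom.id (geomPrimaryTorsion W p))
        (fun _ _ ↦ rfl) (galoisCohomology.map (primaryInclusion W p m) 1 c) ∈ A0 ⊓ Sig := by
  rw [mem_selmerGroup_update_inf_iff, h𝓣, AddSubgroup.mem_inf]
  constructor
  · rintro ⟨hA, hL⟩
    exact ⟨hA, (hLSig c hA).mp hL⟩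
  · rintro ⟨hA, hS⟩
    exact ⟨hA, (hLSig c hA).mpr hS⟩

end TowerStructure

/-! ### §3 Where `𝒦_{v,0}[p^∞] = 0` the tower condition is the Kummer condition -/

section Kummer

variable {K : Type u} [Field K] [NumberField K] (W : WeierstrassCurve K) (p : ℕ) [hp : Fact p.Prime]
  (κ : ZpExtension K p) (m : ℕ)

/-- **`θ_v⁻¹(𝒦_{v,0}) = 𝓚_v`** at a finite place where the `p`-power torsion of the local tower kernel
vanishes (`W.localTowerKerPrimary κ K_v 0 = ⊥`; at `v ∤ p` this is `p ∤ c_v`, B4): the level-`∞`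
condition read at level `m` is the Kummer condition of the Kummer Selmer structure
(file 71 `resH1Hom_map_mem_localTowerKer_iff_of_primary_eq_bot`, as an equality of subgroups of
`H¹(K_v, E[p^m])`). [cite: GreenbergLNM1716, §3 pp. 86–88] -/
theorem comap_localTowerKer_eq_kummerSelmerStructure_inr (v : HeightOneSpectrum (𝓞 K))
    (h0 : W.localTowerKerPrimary κ (v.adicCompletion K) 0 = ⊥) :
    (W.localTowerKer κ (v.adicCompletion K) 0).comap
        ((resH1Hom (subgroupIncl (localSubgroup (κ.layerSubgroup 0) (v.adicCompletion K)))
          (AddMonoidHom.id (localPoints W (v.adicCompletion K))) (fun _ _ ↦ rfl)).comp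
          (galoisCohomology.map
            (W.torsionPointsMapIntertwining ((p ^ m : ℕ) : ℤ) (v.adicCompletion K)) 1)) =
      W.kummerSelmerStructure ((p ^ m : ℕ) : ℤ) (Sum.inr v) := by
  ext x
  rw [AddSubgroup.mem_comap, AddMonoidHom.comp_apply, kummerSelmerStructure_apply]
  exact resH1Hom_map_mem_localTowerKer_iff_of_primary_eq_bot W p κ m (v.adicCompletion K) h0 x

/-- **The tower structure agrees with the Kummer structure off an exceptional set.** If `𝓣` is a
tower structure at level `m` (`𝓣_v = θ_v⁻¹(𝒦_{v,0})` at finite `v`, `𝓣_w = 𝓚_w` at infinite `w`)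
and `𝒦_{v,0}[p^∞] = 0` at every finite place outside a set `T`, then `𝓣_v = 𝓚_v` at every place
outside `T` — the hypothesis `h𝓖off` of the count (C) at finite level (files 63, 68–70).
[cite: GreenbergLNM1716, §3 pp. 86–88] -/
theorem eq_kummerSelmerStructure_of_not_mem
    (𝓣 : SelmerStructure (W.torsionGaloisModule ((p ^ m : ℕ) : ℤ)))
    (h𝓣fin : ∀ v : HeightOneSpectrum (𝓞 K), 𝓣 (Sum.inr v) =
      (W.localTowerKer κ (v.adicCompletion K) 0).comap
        ((resH1Hom (subgroupIncl (localSubgroup (κ.layerSubgroup 0) (v.adicCompletion K)))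
          (AddMonoidHom.id (localPoints W (v.adicCompletion K))) (fun _ _ ↦ rfl)).comp
          (galoisCohomology.map
            (W.torsionPointsMapIntertwining ((p ^ m : ℕ) : ℤ) (v.adicCompletion K)) 1)))
    (h𝓣inf : ∀ w : InfinitePlace K, 𝓣 (Sum.inl w) = W.kummerSelmerStructure ((p ^ m : ℕ) : ℤ) (Sum.inl w))
    (T : Set (HeightOneSpectrum (𝓞 K)))
    (hT : ∀ v : HeightOneSpectrum (𝓞 K), v ∉ T → W.localTowerKerPrimary κ (v.adicCompletion K) 0 = ⊥)
    (v : Place K) (hv : ∀ w ∈ T, v ≠ Sum.inr w) :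
    𝓣 v = W.kummerSelmerStructure ((p ^ m : ℕ) : ℤ) v := by
  rcases v with w | v
  · exact h𝓣inf w
  · have hvT : v ∉ T := fun h ↦ hv v h rfl
    rw [h𝓣fin v]
    exact comap_localTowerKer_eq_kummerSelmerStructure_inr W p κ m v (hT v hvT)

/-- **Kummer ≤ tower at every finite place**: `𝓚_v ≤ θ_v⁻¹(𝒦_{v,0})` (a Kummer class has
`θ_v = 0`) — the hypothesis `h𝓖T : 𝓚_ℓ ≤ 𝓖_ℓ` of the count (C) at finite level at the places of `T`.
[cite: GreenbergLNM1716, §3 p. 86] -/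
theorem kummerSelmerStructure_inr_le_comap_localTowerKer (v : HeightOneSpectrum (𝓞 K)) :
    W.kummerSelmerStructure ((p ^ m : ℕ) : ℤ) (Sum.inr v) ≤
      (W.localTowerKer κ (v.adicCompletion K) 0).comap
        ((resH1Hom (subgroupIncl (localSubgroup (κ.layerSubgroup 0) (v.adicCompletion K)))
          (AddMonoidHom.id (localPoints W (v.adicCompletion K))) (fun _ _ ↦ rfl)).comp
          (galoisCohomology.map
            (W.torsionPointsMapIntertwining ((p ^ m : ℕ) : ℤ) (v.adicCompletion K)) 1)) := by
  intro x hx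
  -- `Place.Completion (Sum.inr v)` is `v.adicCompletion K` by `rfl` (not syntactically)
  have hx' : (x : galoisCohomology
      (GaloisRep.restrictField (v.adicCompletion K) (W.torsionGaloisModule ((p ^ m : ℕ) : ℤ))) 1) ∈
      W.kummerLocalConditionAt ((p ^ m : ℕ) : ℤ) (v.adicCompletion K) := hx
  refine AddSubgroup.mem_comap.mpr ?_
  change resH1Hom (subgroupIncl (localSubgroup (κ.layerSubgroup 0) (v.adicCompletion K)))
      (AddMonoidHom.id (localPoints W (v.adicCompletion K))) (fun _ _ ↦ rfl)
      (galoisCohomology.map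
        (W.torsionPointsMapIntertwining ((p ^ m : ℕ) : ℤ) (v.adicCompletion K)) 1 x) ∈
    W.localTowerKer κ (v.adicCompletion K) 0
  rw [resH1Hom_map_eq_zero_of_mem_kummerLocalConditionAt W p κ m (v.adicCompletion K) hx']
  exact zero_mem _

end Kummer

end Summit.BirchSwinnertonDyer.Rank1Residual.Additive.LevelBridge

end
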